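import Literature.Geometry.DiscreteGeometry.KissingCornerBounds
import HarnessLib

/-!
# The eight tame-contact graphs (Hales 2012, Lemma 8) and Lemma 9 proved in graph form

Topic `Literature/Geometry/DiscreteGeometry`; provefact item for `Hales2012_kissingTwelve` (sibling
of `FejesTothKissingTwelve.lean`, `KissingRigidity.lean`, `KissingNodeDegree.lean`,
`KissingNodeTypes.lean`, `KissingCornerBounds.lean`).

## Source

Hales, arXiv:1209.6043, §7, p. 13: "The website for the computer code contains a list of eight
hypermaps that have been obtained by running the classification algorithm with the tame contact
parameters [Hal12b].  **Lemma 8** (tame hypermap classification). Every hypermap with tame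
contact is isomorphic to a hypermap in the given list of eight hypermaps, or is isomorphic to the
opposite of a hypermap in the list.  *Proof.* By a computer calculation [Hal12b] …
**Lemma 9.** Let `V ∈ 𝒱`. Suppose that `H = hyp(V, E₂(V))` is a hypermap with tame contact. Then
`H` is the FCC or HCP contact hypermap.  *Proof.* The explicit enumeration of hypermaps with tame
contact has eight cases. Two are the hypermaps of the FCC and HCP. The remaining six must be
eliminated. A geometrical argument eliminates one of these cases and linear programming
eliminates the other five.  We claim that one case with a hexagon cannot be realized
geometrically as a contact fan (Figure 1). Indeed, the perimeter of a hexagon with sides `π/3` is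
`2π`. However, the hexagons are geodesically convex, and `2π` is a strict upper bound on the
perimeter of the hexagon. Thus, this case does not exist.  There are some linear programming
constraints that are immediately available to us. 1. The angles around each node sum to `2π`.
2. Each angle of a triangle is `α₃`. 3. Each angle of each rhombus lies between `α₄` and `β₄`.
4. The opposite angles of each rhombus are equal.  By a linear programming computer calculation
[Hal12b], these systems of constraints are infeasible in the remaining five cases."  And
**Theorem 3** (p. 12): "The contact hypermap `hyp(V, E₂(V))` of a packing `V ∈ 𝒱` is a hypermap
with tame contact."

The list [Hal12b] is the file `informal_code/graph_generator/output/fejesToth.txt` of the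
Flyspeck code archive (`HalesFlyspeck2012`; run of May 21, 2010, SVN 1741, "8 hypermaps found",
computation PYWHMHQ): eight planar hypermaps on twelve nodes given by their face lists, with
archive identifiers `23761971401` ("is hcp"), `19501320227` ("is fcc"), `141162467639`,
`237966218391`, `105057915675`, `191947552641`, `62310232837`, `125913905253`.  The linear
programs are `projects_discrete_geom/fejestoth12/contact.mod` (GLPK model) with the driver
`lipstick_ft.ml` (computation JKJNYAA), whose log reads "First two HCP, FCC. Next five
infeasible. Last is ruled out by hexagons perimeter argument in text."

## What is vendored, and in which form

* **Part A — the data.** `tameFaces : Fin 8 → List (List (Fin 12))` are the eight face lists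
  verbatim, in the order of the file; `tameContactGraph i : SimpleGraph (Fin 12)` is the graph of
  the hypermap `i` (two nodes adjacent iff consecutive on a face), entered as adjacency matrices
  `tameAdjM` and checked against the face lists by `decide` (`tameAdjM_eq_facesAdjB`).
* **Part H — the named fact** `Hales2012_contactGraphTame` (Theorem 3 with Lemma 8, *graph
  form*): the contact graph of every `V ∈ 𝒱` is isomorphic to one of the eight
  `tameContactGraph i`.  This is implied by the printed statements — an isomorphism of hypermaps
  (or with the opposite hypermap, which has the same nodes and edges) induces an isomorphism of
  the underlying graphs, and the graph underlying `hyp(V, E₂(V))` is `(V, E₂(V))` — and is weaker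
  than them (the face structure is dropped).  It is the computer-assisted part (hypermap
  generation) together with Theorem 3 (whose proof rests on the main estimate, Theorem 2, and on
  Lemmas 3–6), and stays a named fact.
* **Parts C–F — Lemma 9 PROVED in graph form**: for each of the six graphs `i = 2, …, 7`,
  `IsKissingConfig S → IsEmpty (contactGraph S ≃g tameContactGraph i)`.  The proofs are short
  certificates extracted by hand from the linear programs, using only facts proved in the sibling
  files: at a node `v` of the contact graph of `S` write `y{a,b} = cornerAngle {a, b}` for the
  corner value of a pair of contacts of `v` (`KissingNodeTypes.lean`); then
  (1–2) at a node of type `(p, q, 0)`, `p α₃ + Σ_{rhombus pairs} y = 2π`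
  (`IsKissingConfig.corner_sum`); (1′) at any node, `p α₃ + Σ y + (d − p − q) α₄ ≤ 2π`
  (`IsKissingConfig.corner_sum_le`); (3) `α₄ ≤ y ≤ β₄` on rhombus pairs; (4) opposite corners of
  a rhombus are the same number `y{u,w}`; (5) the two corner values of a rhombus satisfy
  `y{u,w} + y{v,x} ≥ π + 3/5` (`IsKissingConfig.cornerAngle_add_cornerAngle`, the elementary
  form of the quadrilateral area bound `sol ≥ 1.3085` of `contact.mod`).  With these:
  graph `2` (`141162467639`, seven quadrilaterals): nodes `3, 5, 6, 11` give `y{0,2} = 2α₃ > β₄`;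
  graphs `3, 4, 5` (one pentagon): three nodes of type `(2,2,0)` and the inequality (1′) at the
  pentagon node `0` give `α₄ ≤ α₃`; graph `6` (`62310232837`, one pentagon; here the certificate
  also uses the pair bound (5)): nodes `7, 8, 9, 10` and (5) for the rhombi `(5,3,7,8)`,
  `(8,7,9,11)` give `y{6,11} < π/2 < α₄`;
  graph `7` (`125913905253`, two hexagons, the "geometrical" case): every node has type
  `(3, 0, 1)`, so `⟪xᵢ, xᵢ₊₂⟫ = −14/9` around the hexagon `x₀ … x₅`
  (`IsKissingConfig.inner_eq_of_three_triangles`), and an explicit computation in the basis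
  `x₀, x₂, x₄` of `ℝ³` shows that no such hexagon exists (Part F) — an algebraic replacement
  for Hales's perimeter argument.  The node data of each graph are transported to `S` along the
  isomorphism by `transfer_node` (Part B), the combinatorics being checked by `decide`.
* **Part G** identifies graphs `0` and `1` with the HCP and FCC contact graphs of
  `KissingRigidity.lean` (explicit relabellings, `decide`), and **Part H** assembles:
  `Hales2012_contactGraphTame → Hales2012_contactGraphFccOrHcp` (Lemma 9, proved), hence with
  Lemma 10 (`KissingRigidity.lean`) and Lemma 2 (`FejesTothKissingTwelve.lean`)
  `flyspeck_L12 → Hales2012_contactGraphTame → Hales2012_kissingTwelve`: Hales's Theorem 1 now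
  rests on exactly two computer-assisted named facts, `flyspeck_L12` (Lemma 1, the nonlinear
  inequalities) and `Hales2012_contactGraphTame` (Theorem 3 with the classification Lemma 8).
* **Independent re-verification of the paper's computations (2026-08-15; scripts, outputs and
  sha256 manifest attached as evidence to ledger item `wi-04917`).**  (i) The classification
  PYWHMHQ was re-derived from scratch in graph form: an independent exhaustive generator (face
  completion at a fixed dart of a nonfinal face, seeds the `k`-cycles `k = 3, …, 8`; canonical
  BFS codes minimised over all darts and both orientations; cross-checked against brute force over
  all rotation systems for `≤ 6` nodes and against two dart-selection rules) finds, among all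
  2-connected plane graphs with twelve nodes, degrees `2–4` and faces `3–8` satisfying the weight
  condition of Definition 12 — which is equivalent to `Σ_F d₁(|F|) < tgt` together with "every
  node all of whose faces are triangles or quadrilaterals has type `(0,3)`, `(1,3)` or `(2,2)`"
  (take `τ(F) = d₁(|F|)`; `b(p,q) = tgt` at every other type) — exactly eight isomorphism classes
  up to mirror image, and they are the eight graphs of `tameFaces` (none extra, none missing).
  (ii) The Delaunay-triangle table HFBBNUL of Theorem 2 (`A ≥ sol₀ + d₃(r,s,t)`, ten cases; the
  case `(2,0,1)` is sharp: `A(2,2,√(32/3)) = A(2,2,2) = sol₀`), the superadditivity of `d₃`, and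
  the constants of Lemmas 5–6 and Theorem 3 (`4π − 20 sol₀ ∈ [1.540658, 1.540659] < tgt`,
  `d₂(9,0), d₂(6,2), d₂(8,0) + d₂(5,0), d₂(8,0) + 2d₂(4,0) > tgt`) were re-verified with rigorous
  (outward-rounded) interval arithmetic.  This changes no declaration: the text part of Theorem 3
  (fans, hypermaps, Lemmas 3–6, and the azimuth inequality 6621965370 of Lemma 6, not re-run)
  keeps `Hales2012_contactGraphTame` a named fact.

## Contents (namespace `Literature.DiscreteGeom`)

* Part A: `tameFaces`, `tameAdjM`, `facesAdjB`, `tameAdjM_eq_facesAdjB`, `tameContactGraph`,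
  `tameContactGraph_adj`.
* Part B: `transfer_node`.
* Part C: `IsKissingConfig.isEmpty_iso_tameContactGraph_two`.
* Part D: `IsKissingConfig.isEmpty_iso_tameContactGraph_three`, `_four`, `_five`, `_six`.
* Part E–F: `linearIndependent_of_gram_neg`, `IsKissingConfig.isEmpty_iso_tameContactGraph_seven`.
* Part G: `tamePermHcp`, `tamePermFcc`, `tameContactGraph_zero_adj_iff`,
  `tameContactGraph_one_adj_iff`, `nonempty_iso_contactGraph_range_refPt`,
  `nonempty_tameContactGraph_zero_iso_hcp`, `nonempty_tameContactGraph_one_iso_fcc`.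
* Part H: `Hales2012_contactGraphTame` (named fact), `contactGraphTame_fcc_hcp`
  (consistency), `contactGraphFccOrHcp_of_contactGraphTame` (Lemma 9),
  `kissingConfigCongruent_of_contactGraphTame`,
  `hales2012_kissingTwelve_of_L12_of_contactGraphTame`,
  `fejesTothKissingTwelve_of_L12_of_contactGraphTame`.

## References

* T. C. Hales, *A proof of Fejes Tóth's conjecture on sphere packings with kissing number twelve*,
  arXiv:1209.6043 (2012): Theorem 3, p. 12; §7 (Lemma 8, Lemma 9 and its proof, Fig. 1), p. 13;
  proof of Theorem 1, p. 14 (`Hales2012`).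
* T. C. Hales et al., *The Flyspeck project*, source code archive, [Hal12b] of the paper:
  `informal_code/graph_generator/output/fejesToth.txt` (PYWHMHQ),
  `projects_discrete_geom/fejestoth12/contact.mod`, `lipstick_ft.ml` (JKJNYAA)
  (`HalesFlyspeck2012`).
-/

noncomputable section

namespace Literature.Geometry.DiscreteGeometry

open Real RealInnerProductSpace

/-! ### Part A. The eight tame-contact hypermaps (Lemma 8): data -/

/-- **The eight hypermaps with tame contact (Lemma 8), as face lists** — verbatim from the file
`informal_code/graph_generator/output/fejesToth.txt` of the Flyspeck archive, in its order:
archive identifiers `23761971401` (HCP), `19501320227` (FCC), `141162467639`, `237966218391`,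
`105057915675`, `191947552641`, `62310232837`, `125913905253`; each face is the cyclic list of
its nodes `0, …, 11`. [cite: Hales2012, Lemma 8; HalesFlyspeck2012 (fejesToth.txt, PYWHMHQ)] -/
def tameFaces : Fin 8 → List (List (Fin 12)) := ![
  [[0, 1, 2, 3], [0, 3, 4, 5], [4, 3, 6], [6, 3, 2], [6, 2, 7, 8], [7, 2, 1], [7, 1, 9, 10],
    [9, 1, 0], [9, 0, 5], [10, 9, 5, 11], [11, 5, 4], [11, 4, 6, 8], [8, 7, 10], [10, 11, 8]],
  [[0, 1, 2, 3], [0, 3, 4], [4, 3, 5, 6], [5, 3, 2], [5, 2, 7, 8], [7, 2, 1], [7, 1, 9, 10],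
    [9, 1, 0], [9, 0, 4, 11], [11, 4, 6], [6, 5, 8], [8, 7, 10], [10, 9, 11], [11, 6, 8, 10]],
  [[0, 1, 2, 3], [0, 3, 4, 5], [4, 3, 2, 6], [6, 2, 7], [7, 2, 1, 8], [8, 1, 0, 9], [9, 0, 5],
    [9, 5, 10, 11], [10, 5, 4], [10, 4, 6], [11, 10, 6, 7], [11, 7, 8], [8, 9, 11]],
  [[0, 1, 2, 3, 4], [0, 4, 5, 6], [5, 4, 3], [5, 3, 7, 8], [7, 3, 2], [7, 2, 9], [9, 2, 1, 10],
    [10, 1, 0], [10, 0, 6, 11], [11, 6, 8], [6, 5, 8], [11, 8, 7, 9], [9, 10, 11]],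
  [[0, 1, 2, 3, 4], [0, 4, 5, 6], [5, 4, 3], [5, 3, 7, 8], [7, 3, 2], [7, 2, 9, 10], [9, 2, 1],
    [9, 1, 0, 11], [11, 0, 6], [11, 6, 8, 10], [6, 5, 8], [8, 7, 10], [10, 9, 11]],
  [[0, 1, 2, 3, 4], [0, 4, 5, 6], [5, 4, 3], [5, 3, 7], [7, 3, 2, 8], [8, 2, 9], [9, 2, 1],
    [9, 1, 0, 10], [10, 0, 6], [10, 6, 11], [11, 6, 5, 7], [11, 7, 8], [8, 9, 10, 11]],
  [[0, 1, 2, 3, 4], [0, 4, 5, 6], [5, 4, 3], [5, 3, 7, 8], [7, 3, 2], [7, 2, 9], [9, 2, 1],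
    [9, 1, 10, 11], [10, 1, 0], [10, 0, 6], [11, 10, 6, 8], [6, 5, 8], [8, 7, 9, 11]],
  [[0, 1, 2, 3, 4, 5], [0, 5, 6], [6, 5, 7], [7, 5, 4], [7, 4, 8], [8, 4, 3], [8, 3, 9],
    [9, 3, 2], [9, 2, 10], [10, 2, 1], [10, 1, 11], [11, 1, 0], [11, 0, 6], [6, 7, 8, 9, 10, 11]]]

/-- The adjacency matrices of the eight graphs (two nodes adjacent iff consecutive on a face of
`tameFaces`; checked in `tameAdjM_eq_facesAdjB`). [cite: Hales2012, Lemma 8;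
HalesFlyspeck2012 (fejesToth.txt, PYWHMHQ)] -/
def tameAdjM : Fin 8 → Fin 12 → Fin 12 → Bool := ![
  ![
    ![false, true, false, true, false, true, false, false, false, true, false, false],
    ![true, false, true, false, false, false, false, true, false, true, false, false],
    ![false, true, false, true, false, false, true, true, false, false, false, false],
    ![true, false, true, false, true, false, true, false, false, false, false, false],
    ![false, false, false, true, false, true, true, false, false, false, false, true],
    ![true, false, false, false, true, false, false, false, false, true, false, true],
    ![false, false, true, true, true, false, false, false, true, false, false, false],
    ![false, true, true, false, false, false, false, false, true, false, true, false],
    ![false, false, false, false, false, false, true, true, false, false, true, true],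
    ![true, true, false, false, false, true, false, false, false, false, true, false],
    ![false, false, false, false, false, false, false, true, true, true, false, true],
    ![false, false, false, false, true, true, false, false, true, false, true, false]],
  ![
    ![false, true, false, true, true, false, false, false, false, true, false, false],
    ![true, false, true, false, false, false, false, true, false, true, false, false],
    ![false, true, false, true, false, true, false, true, false, false, false, false],
    ![true, false, true, false, true, true, false, false, false, false, false, false],
    ![true, false, false, true, false, false, true, false, false, false, false, true],
    ![false, false, true, true, false, false, true, false, true, false, false, false],
    ![false, false, false, false, true, true, false, false, true, false, false, true],
    ![false, true, true, false, false, false, false, false, true, false, true, false],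
    ![false, false, false, false, false, true, true, true, false, false, true, false],
    ![true, true, false, false, false, false, false, false, false, false, true, true],
    ![false, false, false, false, false, false, false, true, true, true, false, true],
    ![false, false, false, false, true, false, true, false, false, true, true, false]],
  ![
    ![false, true, false, true, false, true, false, false, false, true, false, false],
    ![true, false, true, false, false, false, false, false, true, false, false, false],
    ![false, true, false, true, false, false, true, true, false, false, false, false],
    ![true, false, true, false, true, false, false, false, false, false, false, false],
    ![false, false, false, true, false, true, true, false, false, false, true, false],
    ![true, false, false, false, true, false, false, false, false, true, true, false],
    ![false, false, true, false, true, false, false, true, false, false, true, false],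
    ![false, false, true, false, false, false, true, false, true, false, false, true],
    ![false, true, false, false, false, false, false, true, false, true, false, true],
    ![true, false, false, false, false, true, false, false, true, false, false, true],
    ![false, false, false, false, true, true, true, false, false, false, false, true],
    ![false, false, false, false, false, false, false, true, true, true, true, false]],
  ![
    ![false, true, false, false, true, false, true, false, false, false, true, false],
    ![true, false, true, false, false, false, false, false, false, false, true, false],
    ![false, true, false, true, false, false, false, true, false, true, false, false],
    ![false, false, true, false, true, true, false, true, false, false, false, false],
    ![true, false, false, true, false, true, false, false, false, false, false, false],
    ![false, false, false, true, true, false, true, false, true, false, false, false],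
    ![true, false, false, false, false, true, false, false, true, false, false, true],
    ![false, false, true, true, false, false, false, false, true, true, false, false],
    ![false, false, false, false, false, true, true, true, false, false, false, true],
    ![false, false, true, false, false, false, false, true, false, false, true, true],
    ![true, true, false, false, false, false, false, false, false, true, false, true],
    ![false, false, false, false, false, false, true, false, true, true, true, false]],
  ![
    ![false, true, false, false, true, false, true, false, false, false, false, true],
    ![true, false, true, false, false, false, false, false, false, true, false, false],
    ![false, true, false, true, false, false, false, true, false, true, false, false],
    ![false, false, true, false, true, true, false, true, false, false, false, false],
    ![true, false, false, true, false, true, false, false, false, false, false, false],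
    ![false, false, false, true, true, false, true, false, true, false, false, false],
    ![true, false, false, false, false, true, false, false, true, false, false, true],
    ![false, false, true, true, false, false, false, false, true, false, true, false],
    ![false, false, false, false, false, true, true, true, false, false, true, false],
    ![false, true, true, false, false, false, false, false, false, false, true, true],
    ![false, false, false, false, false, false, false, true, true, true, false, true],
    ![true, false, false, false, false, false, true, false, false, true, true, false]],
  ![
    ![false, true, false, false, true, false, true, false, false, false, true, false],
    ![true, false, true, false, false, false, false, false, false, true, false, false],
    ![false, true, false, true, false, false, false, false, true, true, false, false],
    ![false, false, true, false, true, true, false, true, false, false, false, false],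
    ![true, false, false, true, false, true, false, false, false, false, false, false],
    ![false, false, false, true, true, false, true, true, false, false, false, false],
    ![true, false, false, false, false, true, false, false, false, false, true, true],
    ![false, false, false, true, false, true, false, false, true, false, false, true],
    ![false, false, true, false, false, false, false, true, false, true, false, true],
    ![false, true, true, false, false, false, false, false, true, false, true, false],
    ![true, false, false, false, false, false, true, false, false, true, false, true],
    ![false, false, false, false, false, false, true, true, true, false, true, false]],
  ![
    ![false, true, false, false, true, false, true, false, false, false, true, false],
    ![true, false, true, false, false, false, false, false, false, true, true, false],
    ![false, true, false, true, false, false, false, true, false, true, false, false],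
    ![false, false, true, false, true, true, false, true, false, false, false, false],
    ![true, false, false, true, false, true, false, false, false, false, false, false],
    ![false, false, false, true, true, false, true, false, true, false, false, false],
    ![true, false, false, false, false, true, false, false, true, false, true, false],
    ![false, false, true, true, false, false, false, false, true, true, false, false],
    ![false, false, false, false, false, true, true, true, false, false, false, true],
    ![false, true, true, false, false, false, false, true, false, false, false, true],
    ![true, true, false, false, false, false, true, false, false, false, false, true],
    ![false, false, false, false, false, false, false, false, true, true, true, false]],
  ![
    ![false, true, false, false, false, true, true, false, false, false, false, true],
    ![true, false, true, false, false, false, false, false, false, false, true, true],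
    ![false, true, false, true, false, false, false, false, false, true, true, false],
    ![false, false, true, false, true, false, false, false, true, true, false, false],
    ![false, false, false, true, false, true, false, true, true, false, false, false],
    ![true, false, false, false, true, false, true, true, false, false, false, false],
    ![true, false, false, false, false, true, false, true, false, false, false, true],
    ![false, false, false, false, true, true, true, false, true, false, false, false],
    ![false, false, false, true, true, false, false, true, false, true, false, false],
    ![false, false, true, true, false, false, false, false, true, false, true, false],
    ![false, true, true, false, false, false, false, false, false, true, false, true],
    ![true, true, false, false, false, false, true, false, false, false, true, false]]]

/-- Whether `a, b` are cyclically consecutive in one of the faces `fs` (the edges of a hypermap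
given by its faces). [folklore] -/
def facesAdjB (fs : List (List (Fin 12))) (a b : Fin 12) : Bool :=
  fs.any fun f => (f.zip (f.rotateLeft 1)).any fun p =>
    (p.1 == a && p.2 == b) || (p.1 == b && p.2 == a)

/-- The adjacency matrices agree with the face lists: `a ~ b` iff `a, b` are consecutive on a
face. [cite: Hales2012, Lemma 8; HalesFlyspeck2012 (fejesToth.txt)] -/
theorem tameAdjM_eq_facesAdjB : ∀ i a b, tameAdjM i a b = facesAdjB (tameFaces i) a b := by
  decide

/-- **The graphs of the eight tame-contact hypermaps** (nodes `0, …, 11`, two nodes adjacent iff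
they are consecutive on a face), as simple graphs on `Fin 12` with decidable adjacency.
[cite: Hales2012, Lemma 8; HalesFlyspeck2012 (fejesToth.txt, PYWHMHQ)] -/
def tameContactGraph (i : Fin 8) : SimpleGraph (Fin 12) where
  Adj a b := a ≠ b ∧ (tameAdjM i a b = true ∨ tameAdjM i b a = true)
  symm := ⟨fun _ _ h => ⟨h.1.symm, h.2.symm⟩⟩
  loopless := ⟨fun _ h => h.1 rfl⟩

/-- Adjacency in the eight graphs is decidable. [folklore] -/
instance instDecidableRelTameAdj (i : Fin 8) : DecidableRel (tameContactGraph i).Adj :=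
  fun a b => inferInstanceAs (Decidable (a ≠ b ∧ (tameAdjM i a b = true ∨ tameAdjM i b a = true)))

/-- Unfolding the adjacency of `tameContactGraph`. [folklore] -/
theorem tameContactGraph_adj (i : Fin 8) (a b : Fin 12) :
    (tameContactGraph i).Adj a b ↔ a ≠ b ∧ (tameAdjM i a b = true ∨ tameAdjM i b a = true) :=
  Iff.rfl

/-! ### Part B. Transfer of the node data along an isomorphism with the contact graph -/

/-- **Transfer along an isomorphism.** Let `ψ : G ≃g contactGraph S` identify a finite simple
graph `G` on `Fin n` with the contact graph of `S`, and let `k : Fin n`.  If the triangle pairs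
and the rhombus pairs of `G` at `k` (the same graph-theoretic conditions as in `trianglePairs`,
`rhombusPairs`) are listed by the finsets `T` and `R`, then at the node `ψ k` of the contact graph
of `S`: there are `|T|` triangle pairs and `|R|` rhombus pairs, the rhombus pairs are the images
of the pairs in `R`, the sum of the rhombus corners is the corresponding finite sum, and the degree
is that of `k` in `G`. [folklore] -/
theorem transfer_node {n : ℕ} {G : SimpleGraph (Fin n)} [DecidableRel G.Adj]
    {S : Set (EuclideanSpace ℝ (Fin 3))} (ψ : G ≃g contactGraph S) (k : Fin n)
    (T R : Finset (Sym2 (Fin n)))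
    (hT : ∀ a b, (G.Adj a b ∧ G.Adj k a ∧ G.Adj k b) ↔ s(a, b) ∈ T)
    (hR : ∀ a b, (a ≠ b ∧ ¬G.Adj a b ∧ (G.Adj k a ∧ G.Adj k b) ∧
      ∃ x, x ≠ k ∧ ¬G.Adj k x ∧ G.Adj x a ∧ G.Adj x b) ↔ s(a, b) ∈ R) :
    (trianglePairs S (ψ k)).ncard = T.card ∧ (rhombusPairs S (ψ k)).ncard = R.card ∧
      (∀ a b, s(a, b) ∈ R → s(ψ a, ψ b) ∈ rhombusPairs S (ψ k)) ∧
      ∑ᶠ z ∈ rhombusPairs S (ψ k), cornerAngle S z = ∑ y ∈ R, cornerAngle S (Sym2.map ψ y) ∧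
      ((contactGraph S).neighborSet (ψ k)).ncard = G.degree k := by
  classical
  have hinj : Function.Injective ψ := ψ.injective
  have hsurj : Function.Surjective ψ := ψ.surjective
  have hpT : Sym2.map ψ ⁻¹' trianglePairs S (ψ k) = ↑T := by
    ext z
    induction z using Sym2.ind with
    | h a b =>
      rw [Set.mem_preimage, Sym2.map_mk, mk_mem_trianglePairs, Finset.mem_coe, ← hT]
      simp only [SimpleGraph.Iso.map_adj_iff]
  have hpR : Sym2.map ψ ⁻¹' rhombusPairs S (ψ k) = ↑R := by
    ext z
    induction z using Sym2.ind with
    | h a b =>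
      rw [Set.mem_preimage, Sym2.map_mk, mk_mem_rhombusPairs, Finset.mem_coe, ← hR]
      simp only [SimpleGraph.Iso.map_adj_iff, hinj.ne_iff]
      refine and_congr_right fun _ => and_congr_right fun _ => and_congr_right fun _ => ?_
      constructor
      · rintro ⟨x, h1, h2, h3, h4⟩
        obtain ⟨x', rfl⟩ := hsurj x
        rw [hinj.ne_iff] at h1
        rw [SimpleGraph.Iso.map_adj_iff] at h2 h3 h4
        exact ⟨x', h1, h2, h3, h4⟩
      · rintro ⟨x', h1, h2, h3, h4⟩
        refine ⟨ψ x', hinj.ne_iff.2 h1, ?_, ?_, ?_⟩ <;> rwa [SimpleGraph.Iso.map_adj_iff]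
  have hrangeT : ∀ z ∈ trianglePairs S (ψ k), ∀ a ∈ z, a ∈ Set.range ψ := fun z _ a _ => hsurj a
  have hrangeR : ∀ z ∈ rhombusPairs S (ψ k), ∀ a ∈ z, a ∈ Set.range ψ := fun z _ a _ => hsurj a
  refine ⟨?_, ?_, ?_, ?_, ?_⟩
  · rw [ncard_eq_ncard_preimage_sym2Map hinj hrangeT, hpT, Set.ncard_coe_finset]
  · rw [ncard_eq_ncard_preimage_sym2Map hinj hrangeR, hpR, Set.ncard_coe_finset]
  · intro a b hab
    have h : s(a, b) ∈ Sym2.map ψ ⁻¹' rhombusPairs S (ψ k) := by rw [hpR]; exact hab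
    rwa [Set.mem_preimage, Sym2.map_mk] at h
  · rw [finsum_mem_eq_of_sym2Map hinj hrangeR, hpR, finsum_mem_coe_finset]
  · have himg : (contactGraph S).neighborSet (ψ k) = ψ '' G.neighborSet k := by
      ext b
      rw [SimpleGraph.mem_neighborSet]
      constructor
      · intro h
        obtain ⟨b', rfl⟩ := hsurj b
        exact ⟨b', (SimpleGraph.Iso.map_adj_iff ψ).1 h, rfl⟩
      · rintro ⟨b', hb', rfl⟩
        exact (SimpleGraph.Iso.map_adj_iff ψ).2 hb'
    rw [himg, Set.ncard_image_of_injective _ hinj, ← Set.fintypeCard_eq_ncard]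
    convert SimpleGraph.card_neighborSet_eq_degree G k

/-! ### Part C. Lemma 9 for the hypermap `141162467639` (graph `2`, seven quadrilaterals): proved -/

set_option maxRecDepth 4096 in
/-- **Graph 2 (`141162467639`) is not the contact graph of a kissing configuration.**  Linear
programming certificate: the node equations (`IsKissingConfig.corner_sum`) at the nodes `3`
(type `(0,3,0)`), `5`, `6`, `11` (type `(2,2,0)`) give the corner value of the pair `{0, 2}` as
`2π − (2π − 2α₃) = 2α₃`, above the rhombus bound `β₄`. [cite: Hales2012, Lemma 9 (proof:
"linear programming eliminates the other five"); HalesFlyspeck2012 (contact.mod, JKJNYAA)] -/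
theorem IsKissingConfig.isEmpty_iso_tameContactGraph_two {S : Set (EuclideanSpace ℝ (Fin 3))}
    (hS : IsKissingConfig S) : IsEmpty (contactGraph S ≃g tameContactGraph 2) := by
  refine ⟨fun φ => ?_⟩
  set ψ := φ.symm with hψ
  have hβ := arccos_kappa_lt_two_mul_arccos_third
  -- node 3, type (0, 3, 0)
  obtain ⟨hT3, hR3, hm3, hs3, hd3⟩ :=
    transfer_node ψ 3 ∅ {s(0, 2), s(0, 4), s(2, 4)} (by decide) (by decide)
  have e3 := hS.corner_sum (ψ 3) (by rw [hT3, hR3, hd3]; decide)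
    (Set.nonempty_of_ncard_ne_zero (by rw [hd3]; decide))
  rw [hT3, hs3, Finset.sum_insert (by decide), Finset.sum_insert (by decide),
    Finset.sum_singleton] at e3
  simp only [Sym2.map_mk, Finset.card_empty, Nat.cast_zero, zero_mul, zero_add] at e3
  have b02 := (hS.cornerAngle_bounds_of_mem_rhombusPairs (hm3 0 2 (by decide))).2
  -- node 5, type (2, 2, 0)
  obtain ⟨hT5, hR5, -, hs5, hd5⟩ :=
    transfer_node ψ 5 {s(0, 9), s(4, 10)} {s(0, 4), s(9, 10)} (by decide) (by decide)
  have e5 := hS.corner_sum (ψ 5) (by rw [hT5, hR5, hd5]; decide)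
    (Set.nonempty_of_ncard_ne_zero (by rw [hd5]; decide))
  rw [hT5, hs5, Finset.sum_insert (by decide), Finset.sum_singleton,
    show ({s(0, 9), s(4, 10)} : Finset (Sym2 (Fin 12))).card = 2 by decide] at e5
  simp only [Sym2.map_mk, Nat.cast_ofNat] at e5
  -- node 6, type (2, 2, 0)
  obtain ⟨hT6, hR6, -, hs6, hd6⟩ :=
    transfer_node ψ 6 {s(2, 7), s(4, 10)} {s(2, 4), s(7, 10)} (by decide) (by decide)
  have e6 := hS.corner_sum (ψ 6) (by rw [hT6, hR6, hd6]; decide)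
    (Set.nonempty_of_ncard_ne_zero (by rw [hd6]; decide))
  rw [hT6, hs6, Finset.sum_insert (by decide), Finset.sum_singleton,
    show ({s(2, 7), s(4, 10)} : Finset (Sym2 (Fin 12))).card = 2 by decide] at e6
  simp only [Sym2.map_mk, Nat.cast_ofNat] at e6
  -- node 11, type (2, 2, 0)
  obtain ⟨hT11, hR11, -, hs11, hd11⟩ :=
    transfer_node ψ 11 {s(7, 8), s(8, 9)} {s(7, 10), s(9, 10)} (by decide) (by decide)
  have e11 := hS.corner_sum (ψ 11) (by rw [hT11, hR11, hd11]; decide)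
    (Set.nonempty_of_ncard_ne_zero (by rw [hd11]; decide))
  rw [hT11, hs11, Finset.sum_insert (by decide), Finset.sum_singleton,
    show ({s(7, 8), s(8, 9)} : Finset (Sym2 (Fin 12))).card = 2 by decide] at e11
  simp only [Sym2.map_mk, Nat.cast_ofNat] at e11
  linarith

/-! ### Part D. Lemma 9 for the hypermaps with a pentagon (graphs `3`–`6`): proved -/

set_option maxRecDepth 4096 in
/-- **Graph 3 (`237966218391`) is not the contact graph of a kissing configuration.**  Linear
programming certificate: the node equations at the nodes `5`, `7`, `11` (type `(2,2,0)`) give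
`cornerAngle {4,6} + cornerAngle {6,10} = 2π − 2α₃` for the two rhombus corners at the pentagon
node `0` (type `(1,2,1)`), whose corner-sum inequality `α₃ + (2π − 2α₃) + α₄ ≤ 2π` then forces
`α₄ ≤ α₃`. [cite: Hales2012, Lemma 9 (proof: "linear programming eliminates the other five");
HalesFlyspeck2012 (contact.mod, JKJNYAA)] -/
theorem IsKissingConfig.isEmpty_iso_tameContactGraph_three {S : Set (EuclideanSpace ℝ (Fin 3))}
    (hS : IsKissingConfig S) : IsEmpty (contactGraph S ≃g tameContactGraph 3) := by
  refine ⟨fun φ => ?_⟩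
  set ψ := φ.symm with hψ
  have hα := arccos_third_lt_arccos_sigma
  -- node 5: type (2, 2, 0)
  obtain ⟨hT5, hR5, hm5, hs5, hd5⟩ :=
    transfer_node ψ 5 {s(3, 4), s(6, 8)} {s(3, 8), s(4, 6)} (by decide) (by decide)
  have e5 := hS.corner_sum (ψ 5) (by rw [hT5, hR5, hd5]; decide)
    (Set.nonempty_of_ncard_ne_zero (by rw [hd5]; decide))
  rw [hT5, hs5, Finset.sum_insert (by decide), Finset.sum_singleton,
    show ({s(3, 4), s(6, 8)} : Finset (Sym2 (Fin 12))).card = 2 by decide] at e5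
  simp only [Sym2.map_mk, Nat.cast_ofNat] at e5
  -- node 7: type (2, 2, 0)
  obtain ⟨hT7, hR7, hm7, hs7, hd7⟩ :=
    transfer_node ψ 7 {s(2, 3), s(2, 9)} {s(3, 8), s(8, 9)} (by decide) (by decide)
  have e7 := hS.corner_sum (ψ 7) (by rw [hT7, hR7, hd7]; decide)
    (Set.nonempty_of_ncard_ne_zero (by rw [hd7]; decide))
  rw [hT7, hs7, Finset.sum_insert (by decide), Finset.sum_singleton,
    show ({s(2, 3), s(2, 9)} : Finset (Sym2 (Fin 12))).card = 2 by decide] at e7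
  simp only [Sym2.map_mk, Nat.cast_ofNat] at e7
  -- node 11: type (2, 2, 0)
  obtain ⟨hT11, hR11, hm11, hs11, hd11⟩ :=
    transfer_node ψ 11 {s(6, 8), s(9, 10)} {s(6, 10), s(8, 9)} (by decide) (by decide)
  have e11 := hS.corner_sum (ψ 11) (by rw [hT11, hR11, hd11]; decide)
    (Set.nonempty_of_ncard_ne_zero (by rw [hd11]; decide))
  rw [hT11, hs11, Finset.sum_insert (by decide), Finset.sum_singleton,
    show ({s(6, 8), s(9, 10)} : Finset (Sym2 (Fin 12))).card = 2 by decide] at e11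
  simp only [Sym2.map_mk, Nat.cast_ofNat] at e11
  -- node 0: type (1, 2, 1) — corner-sum inequality
  obtain ⟨hT0, hR0, hm0, hs0, hd0⟩ :=
    transfer_node ψ 0 {s(1, 10)} {s(4, 6), s(6, 10)} (by decide) (by decide)
  have e0 := (hS.corner_sum_le (ψ 0)).2
  rw [hT0, hR0, hs0, hd0, Finset.sum_insert (by decide), Finset.sum_singleton,
    show ({s(1, 10)} : Finset (Sym2 (Fin 12))).card = 1 by decide,
    show ({s(4, 6), s(6, 10)} : Finset (Sym2 (Fin 12))).card = 2 by decide,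
    show (tameContactGraph 3).degree 0 = 4 by decide] at e0
  simp only [Sym2.map_mk, Nat.cast_one, one_mul, Nat.cast_ofNat] at e0
  linarith

set_option maxRecDepth 4096 in
/-- **Graph 4 (`105057915675`) is not the contact graph of a kissing configuration.**  Linear
programming certificate: the node equations at the nodes `5`, `7`, `9` (type `(2,2,0)`) give
`cornerAngle {1,11} + cornerAngle {4,6} = 2π − 2α₃` for the two rhombus corners at the pentagon
node `0` (type `(1,2,1)`), whose corner-sum inequality then forces `α₄ ≤ α₃`. [cite: Hales2012,
Lemma 9 (proof: "linear programming eliminates the other five"); HalesFlyspeck2012 (contact.mod,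
JKJNYAA)] -/
theorem IsKissingConfig.isEmpty_iso_tameContactGraph_four {S : Set (EuclideanSpace ℝ (Fin 3))}
    (hS : IsKissingConfig S) : IsEmpty (contactGraph S ≃g tameContactGraph 4) := by
  refine ⟨fun φ => ?_⟩
  set ψ := φ.symm with hψ
  have hα := arccos_third_lt_arccos_sigma
  -- node 5: type (2, 2, 0)
  obtain ⟨hT5, hR5, hm5, hs5, hd5⟩ :=
    transfer_node ψ 5 {s(3, 4), s(6, 8)} {s(3, 8), s(4, 6)} (by decide) (by decide)
  have e5 := hS.corner_sum (ψ 5) (by rw [hT5, hR5, hd5]; decide)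
    (Set.nonempty_of_ncard_ne_zero (by rw [hd5]; decide))
  rw [hT5, hs5, Finset.sum_insert (by decide), Finset.sum_singleton,
    show ({s(3, 4), s(6, 8)} : Finset (Sym2 (Fin 12))).card = 2 by decide] at e5
  simp only [Sym2.map_mk, Nat.cast_ofNat] at e5
  -- node 7: type (2, 2, 0)
  obtain ⟨hT7, hR7, hm7, hs7, hd7⟩ :=
    transfer_node ψ 7 {s(2, 3), s(8, 10)} {s(2, 10), s(3, 8)} (by decide) (by decide)
  have e7 := hS.corner_sum (ψ 7) (by rw [hT7, hR7, hd7]; decide)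
    (Set.nonempty_of_ncard_ne_zero (by rw [hd7]; decide))
  rw [hT7, hs7, Finset.sum_insert (by decide), Finset.sum_singleton,
    show ({s(2, 3), s(8, 10)} : Finset (Sym2 (Fin 12))).card = 2 by decide] at e7
  simp only [Sym2.map_mk, Nat.cast_ofNat] at e7
  -- node 9: type (2, 2, 0)
  obtain ⟨hT9, hR9, hm9, hs9, hd9⟩ :=
    transfer_node ψ 9 {s(1, 2), s(10, 11)} {s(1, 11), s(2, 10)} (by decide) (by decide)
  have e9 := hS.corner_sum (ψ 9) (by rw [hT9, hR9, hd9]; decide)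
    (Set.nonempty_of_ncard_ne_zero (by rw [hd9]; decide))
  rw [hT9, hs9, Finset.sum_insert (by decide), Finset.sum_singleton,
    show ({s(1, 2), s(10, 11)} : Finset (Sym2 (Fin 12))).card = 2 by decide] at e9
  simp only [Sym2.map_mk, Nat.cast_ofNat] at e9
  -- node 0: type (1, 2, 1) — corner-sum inequality
  obtain ⟨hT0, hR0, hm0, hs0, hd0⟩ :=
    transfer_node ψ 0 {s(6, 11)} {s(1, 11), s(4, 6)} (by decide) (by decide)
  have e0 := (hS.corner_sum_le (ψ 0)).2
  rw [hT0, hR0, hs0, hd0, Finset.sum_insert (by decide), Finset.sum_singleton,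
    show ({s(6, 11)} : Finset (Sym2 (Fin 12))).card = 1 by decide,
    show ({s(1, 11), s(4, 6)} : Finset (Sym2 (Fin 12))).card = 2 by decide,
    show (tameContactGraph 4).degree 0 = 4 by decide] at e0
  simp only [Sym2.map_mk, Nat.cast_one, one_mul, Nat.cast_ofNat] at e0
  linarith

set_option maxRecDepth 4096 in
/-- **Graph 5 (`191947552641`) is not the contact graph of a kissing configuration.**  Linear
programming certificate: the node equations at the nodes `5`, `11`, `9` (type `(2,2,0)`) give
`cornerAngle {1,10} + cornerAngle {4,6} = 2π − 2α₃` for the two rhombus corners at the pentagon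
node `0` (type `(1,2,1)`), whose corner-sum inequality then forces `α₄ ≤ α₃`. [cite: Hales2012,
Lemma 9 (proof: "linear programming eliminates the other five"); HalesFlyspeck2012 (contact.mod,
JKJNYAA)] -/
theorem IsKissingConfig.isEmpty_iso_tameContactGraph_five {S : Set (EuclideanSpace ℝ (Fin 3))}
    (hS : IsKissingConfig S) : IsEmpty (contactGraph S ≃g tameContactGraph 5) := by
  refine ⟨fun φ => ?_⟩
  set ψ := φ.symm with hψ
  have hα := arccos_third_lt_arccos_sigma
  -- node 5: type (2, 2, 0)
  obtain ⟨hT5, hR5, hm5, hs5, hd5⟩ :=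
    transfer_node ψ 5 {s(3, 4), s(3, 7)} {s(4, 6), s(6, 7)} (by decide) (by decide)
  have e5 := hS.corner_sum (ψ 5) (by rw [hT5, hR5, hd5]; decide)
    (Set.nonempty_of_ncard_ne_zero (by rw [hd5]; decide))
  rw [hT5, hs5, Finset.sum_insert (by decide), Finset.sum_singleton,
    show ({s(3, 4), s(3, 7)} : Finset (Sym2 (Fin 12))).card = 2 by decide] at e5
  simp only [Sym2.map_mk, Nat.cast_ofNat] at e5
  -- node 11: type (2, 2, 0)
  obtain ⟨hT11, hR11, hm11, hs11, hd11⟩ :=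
    transfer_node ψ 11 {s(6, 10), s(7, 8)} {s(6, 7), s(8, 10)} (by decide) (by decide)
  have e11 := hS.corner_sum (ψ 11) (by rw [hT11, hR11, hd11]; decide)
    (Set.nonempty_of_ncard_ne_zero (by rw [hd11]; decide))
  rw [hT11, hs11, Finset.sum_insert (by decide), Finset.sum_singleton,
    show ({s(6, 10), s(7, 8)} : Finset (Sym2 (Fin 12))).card = 2 by decide] at e11
  simp only [Sym2.map_mk, Nat.cast_ofNat] at e11
  -- node 9: type (2, 2, 0)
  obtain ⟨hT9, hR9, hm9, hs9, hd9⟩ :=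
    transfer_node ψ 9 {s(1, 2), s(2, 8)} {s(1, 10), s(8, 10)} (by decide) (by decide)
  have e9 := hS.corner_sum (ψ 9) (by rw [hT9, hR9, hd9]; decide)
    (Set.nonempty_of_ncard_ne_zero (by rw [hd9]; decide))
  rw [hT9, hs9, Finset.sum_insert (by decide), Finset.sum_singleton,
    show ({s(1, 2), s(2, 8)} : Finset (Sym2 (Fin 12))).card = 2 by decide] at e9
  simp only [Sym2.map_mk, Nat.cast_ofNat] at e9
  -- node 0: type (1, 2, 1) — corner-sum inequality
  obtain ⟨hT0, hR0, hm0, hs0, hd0⟩ :=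
    transfer_node ψ 0 {s(6, 10)} {s(1, 10), s(4, 6)} (by decide) (by decide)
  have e0 := (hS.corner_sum_le (ψ 0)).2
  rw [hT0, hR0, hs0, hd0, Finset.sum_insert (by decide), Finset.sum_singleton,
    show ({s(6, 10)} : Finset (Sym2 (Fin 12))).card = 1 by decide,
    show ({s(1, 10), s(4, 6)} : Finset (Sym2 (Fin 12))).card = 2 by decide,
    show (tameContactGraph 5).degree 0 = 4 by decide] at e0
  simp only [Sym2.map_mk, Nat.cast_one, one_mul, Nat.cast_ofNat] at e0
  linarith

set_option maxRecDepth 4096 in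
/-- **Graph 6 (`62310232837`) is not the contact graph of a kissing configuration.**  Linear
programming certificate: the node equations at the nodes `7`, `9`, `10` (type `(2,2,0)`) and `8`
(type `(1,3,0)`) together with the corner-pair bounds `≥ π + 3/5` of the rhombi `(5,3,7,8)` and
`(8,7,9,11)` give `cornerAngle {6,11} ≤ 2π − 3α₃ − 6/5 = π − arccos (23/27) − 6/5 < π/2`, below
the rhombus bound `α₄ > π/2` (this case uses the quadrilateral area bound of the linear
programs, in its elementary angle form `IsKissingConfig.cornerAngle_add_cornerAngle`). [cite:
Hales2012, Lemma 9 (proof: "linear programming eliminates the other five"); HalesFlyspeck2012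
(contact.mod, JKJNYAA)] -/
theorem IsKissingConfig.isEmpty_iso_tameContactGraph_six {S : Set (EuclideanSpace ℝ (Fin 3))}
    (hS : IsKissingConfig S) : IsEmpty (contactGraph S ≃g tameContactGraph 6) := by
  refine ⟨fun φ => ?_⟩
  set ψ := φ.symm with hψ
  have hα4 := pi_div_two_lt_arccos_sigma
  have h3 := three_mul_arccos_third
  have hhalf := one_half_lt_arccos
  have hπ := pi_lt_d2
  -- node 7: type (2, 2, 0)
  obtain ⟨hT7, hR7, hm7, hs7, hd7⟩ :=
    transfer_node ψ 7 {s(2, 3), s(2, 9)} {s(3, 8), s(8, 9)} (by decide) (by decide)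
  have e7 := hS.corner_sum (ψ 7) (by rw [hT7, hR7, hd7]; decide)
    (Set.nonempty_of_ncard_ne_zero (by rw [hd7]; decide))
  rw [hT7, hs7, Finset.sum_insert (by decide), Finset.sum_singleton,
    show ({s(2, 3), s(2, 9)} : Finset (Sym2 (Fin 12))).card = 2 by decide] at e7
  simp only [Sym2.map_mk, Nat.cast_ofNat] at e7
  -- node 8: type (1, 3, 0)
  obtain ⟨hT8, hR8, hm8, hs8, hd8⟩ :=
    transfer_node ψ 8 {s(5, 6)} {s(5, 7), s(6, 11), s(7, 11)} (by decide) (by decide)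
  have e8 := hS.corner_sum (ψ 8) (by rw [hT8, hR8, hd8]; decide)
    (Set.nonempty_of_ncard_ne_zero (by rw [hd8]; decide))
  rw [hT8, hs8, Finset.sum_insert (by decide), Finset.sum_insert (by decide),
    Finset.sum_singleton, show ({s(5, 6)} : Finset (Sym2 (Fin 12))).card = 1 by decide] at e8
  simp only [Sym2.map_mk, Nat.cast_one, one_mul] at e8
  -- node 9: type (2, 2, 0)
  obtain ⟨hT9, hR9, hm9, hs9, hd9⟩ :=
    transfer_node ψ 9 {s(1, 2), s(2, 7)} {s(1, 11), s(7, 11)} (by decide) (by decide)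
  have e9 := hS.corner_sum (ψ 9) (by rw [hT9, hR9, hd9]; decide)
    (Set.nonempty_of_ncard_ne_zero (by rw [hd9]; decide))
  rw [hT9, hs9, Finset.sum_insert (by decide), Finset.sum_singleton,
    show ({s(1, 2), s(2, 7)} : Finset (Sym2 (Fin 12))).card = 2 by decide] at e9
  simp only [Sym2.map_mk, Nat.cast_ofNat] at e9
  -- node 10: type (2, 2, 0)
  obtain ⟨hT10, hR10, hm10, hs10, hd10⟩ :=
    transfer_node ψ 10 {s(0, 1), s(0, 6)} {s(1, 11), s(6, 11)} (by decide) (by decide)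
  have e10 := hS.corner_sum (ψ 10) (by rw [hT10, hR10, hd10]; decide)
    (Set.nonempty_of_ncard_ne_zero (by rw [hd10]; decide))
  rw [hT10, hs10, Finset.sum_insert (by decide), Finset.sum_singleton,
    show ({s(0, 1), s(0, 6)} : Finset (Sym2 (Fin 12))).card = 2 by decide] at e10
  simp only [Sym2.map_mk, Nat.cast_ofNat] at e10
  -- rhombus (5, 3, 7, 8): the two corner values sum to more than π + 3/5
  have p1 := (hS.cornerAngle_add_cornerAngle (v := ψ 5) (u := ψ 3) (x := ψ 7) (w := ψ 8)
    ((SimpleGraph.Iso.map_adj_iff ψ).2 (by decide : (tameContactGraph 6).Adj 5 3))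
    ((SimpleGraph.Iso.map_adj_iff ψ).2 (by decide : (tameContactGraph 6).Adj 5 8))
    ((SimpleGraph.Iso.map_adj_iff ψ).2 (by decide : (tameContactGraph 6).Adj 7 3))
    ((SimpleGraph.Iso.map_adj_iff ψ).2 (by decide : (tameContactGraph 6).Adj 7 8))
    (fun h => absurd (ψ.injective h) (by decide))
    (fun h => absurd (ψ.injective h) (by decide))
    (fun h => absurd ((SimpleGraph.Iso.map_adj_iff ψ).1 h) (by decide))
    (fun h => absurd ((SimpleGraph.Iso.map_adj_iff ψ).1 h) (by decide))).2.2.2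
  -- rhombus (8, 7, 9, 11): the two corner values sum to more than π + 3/5
  have p2 := (hS.cornerAngle_add_cornerAngle (v := ψ 8) (u := ψ 7) (x := ψ 9) (w := ψ 11)
    ((SimpleGraph.Iso.map_adj_iff ψ).2 (by decide : (tameContactGraph 6).Adj 8 7))
    ((SimpleGraph.Iso.map_adj_iff ψ).2 (by decide : (tameContactGraph 6).Adj 8 11))
    ((SimpleGraph.Iso.map_adj_iff ψ).2 (by decide : (tameContactGraph 6).Adj 9 7))
    ((SimpleGraph.Iso.map_adj_iff ψ).2 (by decide : (tameContactGraph 6).Adj 9 11))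
    (fun h => absurd (ψ.injective h) (by decide))
    (fun h => absurd (ψ.injective h) (by decide))
    (fun h => absurd ((SimpleGraph.Iso.map_adj_iff ψ).1 h) (by decide))
    (fun h => absurd ((SimpleGraph.Iso.map_adj_iff ψ).1 h) (by decide))).2.2.2
  have lb := (hS.cornerAngle_bounds_of_mem_rhombusPairs (hm10 6 11 (by decide))).1
  linarith

/-! ### Part E–F. Lemma 9 for the hypermap `125913905253` (graph `7`, two hexagons): proved -/

/-- Three vectors of squared norm `4` with pairwise inner products `−14/9` are linearly
independent. [folklore] -/
theorem linearIndependent_of_gram_neg {p : Fin 3 → EuclideanSpace ℝ (Fin 3)}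
    (hd : ∀ i, ⟪p i, p i⟫ = 4) (ho : ∀ i j, i ≠ j → ⟪p i, p j⟫ = -14 / 9) :
    LinearIndependent ℝ p := by
  rw [Fintype.linearIndependent_iff]
  intro g hg i
  have h : ∀ j, ⟪∑ i, g i • p i, p j⟫ = 0 := fun j => by rw [hg, inner_zero_left]
  have e0 := h 0
  have e1 := h 1
  have e2 := h 2
  simp only [inner_add_left, real_inner_smul_left, Fin.sum_univ_three, hd,
    ho 0 1 (by decide), ho 0 2 (by decide), ho 1 0 (by decide), ho 1 2 (by decide),
    ho 2 0 (by decide), ho 2 1 (by decide)] at e0 e1 e2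
  have g0 : g 0 = 0 := by linarith
  have g1 : g 1 = 0 := by linarith
  have g2 : g 2 = 0 := by linarith
  fin_cases i <;> assumption

set_option maxRecDepth 4096 in
/-- **Graph 7 (`125913905253`, the hypermap with two hexagons) is not the contact graph of a
kissing configuration.**  Hales: "the perimeter of a hexagon with sides `π/3` is `2π`. However,
the hexagons are geodesically convex, and `2π` is a strict upper bound on the perimeter of the
hexagon."  Here an algebraic proof: every node has type `(3, 0, 1)`, so along the hexagon
`x₀ x₁ … x₅` (the face `0 1 2 3 4 5`) `⟪xᵢ, xᵢ₊₂⟫ = −14/9` (`inner_eq_of_three_triangles`),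
besides `⟪xᵢ, xᵢ₊₁⟫ = 2`; expanding `x₁` in the basis `x₀, x₂, x₄` of `ℝ³` and `x₃` in the basis
`x₂, x₄, x₀` gives `(3c + 4)(33c + 124) = 0` for `c = c₁ = ⟪x₁, x₄⟫` and for `c = c₀ = ⟪x₃, x₀⟫`
(from `‖x₁‖² = ‖x₃‖² = 4`), while `⟪x₁, x₃⟫ = −14/9` reads
`(324 + 63c₁)(c₀ + 2) + 2(252 + 99c₁) = −2800/9`, false for all four choices of `(c₀, c₁)`.
[cite: Hales2012, Lemma 9 (proof, the case with a hexagon, Fig. 1)] -/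
theorem IsKissingConfig.isEmpty_iso_tameContactGraph_seven {S : Set (EuclideanSpace ℝ (Fin 3))}
    (hS : IsKissingConfig S) : IsEmpty (contactGraph S ≃g tameContactGraph 7) := by
  refine ⟨fun φ => ?_⟩
  set ψ := φ.symm with hψ
  have adj : ∀ a b : Fin 12, (tameContactGraph 7).Adj a b → (contactGraph S).Adj (ψ a) (ψ b) :=
    fun a b h => (SimpleGraph.Iso.map_adj_iff ψ).2 h
  have nadj : ∀ a b : Fin 12, ¬(tameContactGraph 7).Adj a b →
      ¬(contactGraph S).Adj (ψ a) (ψ b) :=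
    fun a b h h' => h ((SimpleGraph.Iso.map_adj_iff ψ).1 h')
  have ne : ∀ a b : Fin 12, a ≠ b → ψ a ≠ ψ b := fun a b h h' => h (ψ.injective h')
  set x : Fin 12 → EuclideanSpace ℝ (Fin 3) := fun i => (ψ i : EuclideanSpace ℝ (Fin 3)) with hx
  have n4 : ∀ i, ⟪x i, x i⟫ = 4 := fun i => by
    rw [real_inner_self_eq_norm_sq, hx, hS.norm_eq (ψ i).2]; norm_num
  have i2 : ∀ a b : Fin 12, (tameContactGraph 7).Adj a b → ⟪x a, x b⟫ = 2 := fun a b h =>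
    inner_eq_two_of_dist_eq_two (hS.norm_eq (ψ a).2) (hS.norm_eq (ψ b).2) (adj a b h)
  -- second neighbours along the hexagon `0 1 2 3 4 5`
  have s02 : ⟪x 0, x 2⟫ = -14 / 9 :=
    hS.inner_eq_of_three_triangles (v := ψ 1) (adj 1 0 (by decide)) (adj 1 11 (by decide))
      (adj 1 10 (by decide)) (adj 1 2 (by decide)) (adj 0 11 (by decide)) (adj 11 10 (by decide))
      (adj 10 2 (by decide)) (ne 0 10 (by decide)) (nadj 0 10 (by decide)) (ne 11 2 (by decide))
      (nadj 11 2 (by decide))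
  have s13 : ⟪x 1, x 3⟫ = -14 / 9 :=
    hS.inner_eq_of_three_triangles (v := ψ 2) (adj 2 1 (by decide)) (adj 2 10 (by decide))
      (adj 2 9 (by decide)) (adj 2 3 (by decide)) (adj 1 10 (by decide)) (adj 10 9 (by decide))
      (adj 9 3 (by decide)) (ne 1 9 (by decide)) (nadj 1 9 (by decide)) (ne 10 3 (by decide))
      (nadj 10 3 (by decide))
  have s24 : ⟪x 2, x 4⟫ = -14 / 9 :=
    hS.inner_eq_of_three_triangles (v := ψ 3) (adj 3 2 (by decide)) (adj 3 9 (by decide))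
      (adj 3 8 (by decide)) (adj 3 4 (by decide)) (adj 2 9 (by decide)) (adj 9 8 (by decide))
      (adj 8 4 (by decide)) (ne 2 8 (by decide)) (nadj 2 8 (by decide)) (ne 9 4 (by decide))
      (nadj 9 4 (by decide))
  have s40 : ⟪x 4, x 0⟫ = -14 / 9 :=
    hS.inner_eq_of_three_triangles (v := ψ 5) (adj 5 4 (by decide)) (adj 5 7 (by decide))
      (adj 5 6 (by decide)) (adj 5 0 (by decide)) (adj 4 7 (by decide)) (adj 7 6 (by decide))
      (adj 6 0 (by decide)) (ne 4 6 (by decide)) (nadj 4 6 (by decide)) (ne 7 0 (by decide))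
      (nadj 7 0 (by decide))
  have h01 := i2 0 1 (by decide)
  have h12 := i2 1 2 (by decide)
  have h23 := i2 2 3 (by decide)
  have h34 := i2 3 4 (by decide)
  have h20 : ⟪x 2, x 0⟫ = -14 / 9 := by rw [real_inner_comm]; exact s02
  have h04 : ⟪x 0, x 4⟫ = -14 / 9 := by rw [real_inner_comm]; exact s40
  have h42 : ⟪x 4, x 2⟫ = -14 / 9 := by rw [real_inner_comm]; exact s24
  have h10 : ⟪x 1, x 0⟫ = 2 := by rw [real_inner_comm]; exact h01
  have h21 : ⟪x 2, x 1⟫ = 2 := by rw [real_inner_comm]; exact h12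
  have h32 : ⟪x 3, x 2⟫ = 2 := by rw [real_inner_comm]; exact h23
  have h43 : ⟪x 4, x 3⟫ = 2 := by rw [real_inner_comm]; exact h34
  -- the basis `x 0, x 2, x 4`
  have hli : LinearIndependent ℝ ![x 0, x 2, x 4] := by
    refine linearIndependent_of_gram_neg (fun i => ?_) (fun i j hij => ?_)
    · fin_cases i
      · exact n4 0
      · exact n4 2
      · exact n4 4
    · fin_cases i <;> fin_cases j
      · exact absurd rfl hij
      · exact s02
      · exact h04
      · exact h20
      · exact absurd rfl hij
      · exact s24
      · exact s40
      · exact h42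
      · exact absurd rfl hij
  set c1 := ⟪x 1, x 4⟫ with hc1
  set c0 := ⟪x 3, x 0⟫ with hc0
  have h41 : ⟪x 4, x 1⟫ = c1 := by rw [real_inner_comm]
  have h03 : ⟪x 0, x 3⟫ = c0 := by rw [real_inner_comm]
  -- expansion of `x 1` in the basis and the quadratic equation for `c1`
  have e1 : x 1 = ((324 + 63 * c1) / 200) • (x 0 + x 2) + ((252 + 99 * c1) / 200) • x 4 := by
    rw [← sub_eq_zero]
    refine eq_zero_of_inner_linearIndependent_fin_three hli fun i => ?_
    fin_cases i
    · show ⟪x 1 - (((324 + 63 * c1) / 200) • (x 0 + x 2) + ((252 + 99 * c1) / 200) • x 4),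
        x 0⟫ = 0
      rw [inner_sub_left, inner_add_left, real_inner_smul_left, real_inner_smul_left,
        inner_add_left, h10, n4, h20, s40]
      ring
    · show ⟪x 1 - (((324 + 63 * c1) / 200) • (x 0 + x 2) + ((252 + 99 * c1) / 200) • x 4),
        x 2⟫ = 0
      rw [inner_sub_left, inner_add_left, real_inner_smul_left, real_inner_smul_left,
        inner_add_left, h12, s02, n4, h42]
      ring
    · show ⟪x 1 - (((324 + 63 * c1) / 200) • (x 0 + x 2) + ((252 + 99 * c1) / 200) • x 4),
        x 4⟫ = 0
      rw [inner_sub_left, inner_add_left, real_inner_smul_left, real_inner_smul_left,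
        inner_add_left, h04, s24, n4]
      ring
  have q1 : (3 * c1 + 4) * (33 * c1 + 124) = 0 := by
    have h := congrArg (fun z => ⟪z, x 1⟫) e1
    simp only [inner_add_left, real_inner_smul_left, n4, h01, h21, h41] at h
    linear_combination (-200) * h
  -- expansion of `x 3` in the basis and the quadratic equation for `c0`
  have e3 : x 3 = ((324 + 63 * c0) / 200) • (x 2 + x 4) + ((252 + 99 * c0) / 200) • x 0 := by
    rw [← sub_eq_zero]
    refine eq_zero_of_inner_linearIndependent_fin_three hli fun i => ?_
    fin_cases i
    · show ⟪x 3 - (((324 + 63 * c0) / 200) • (x 2 + x 4) + ((252 + 99 * c0) / 200) • x 0),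
        x 0⟫ = 0
      rw [inner_sub_left, inner_add_left, real_inner_smul_left, real_inner_smul_left,
        inner_add_left, h20, s40, n4]
      ring
    · show ⟪x 3 - (((324 + 63 * c0) / 200) • (x 2 + x 4) + ((252 + 99 * c0) / 200) • x 0),
        x 2⟫ = 0
      rw [inner_sub_left, inner_add_left, real_inner_smul_left, real_inner_smul_left,
        inner_add_left, h32, n4, h42, s02]
      ring
    · show ⟪x 3 - (((324 + 63 * c0) / 200) • (x 2 + x 4) + ((252 + 99 * c0) / 200) • x 0),
        x 4⟫ = 0
      rw [inner_sub_left, inner_add_left, real_inner_smul_left, real_inner_smul_left,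
        inner_add_left, h34, s24, n4, h04]
      ring
  have q0 : (3 * c0 + 4) * (33 * c0 + 124) = 0 := by
    have h := congrArg (fun z => ⟪z, x 3⟫) e3
    simp only [inner_add_left, real_inner_smul_left, n4, h23, h43, h03] at h
    linear_combination (-200) * h
  -- the relation from `⟪x 1, x 3⟫ = -14/9`
  have r13 : (324 + 63 * c1) / 200 * (c0 + 2) + (252 + 99 * c1) / 200 * 2 = -14 / 9 := by
    have h := s13
    rw [e1, inner_add_left, real_inner_smul_left, real_inner_smul_left, inner_add_left, h03,
      h23, h43] at h
    linarith
  rcases mul_eq_zero.1 q0 with h0 | h0 <;> rcases mul_eq_zero.1 q1 with h1 | h1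
  · have hc0' : c0 = -4 / 3 := by linarith
    have hc1' : c1 = -4 / 3 := by linarith
    rw [hc0', hc1'] at r13
    norm_num at r13
  · have hc0' : c0 = -4 / 3 := by linarith
    have hc1' : c1 = -124 / 33 := by linarith
    rw [hc0', hc1'] at r13
    norm_num at r13
  · have hc0' : c0 = -124 / 33 := by linarith
    have hc1' : c1 = -4 / 3 := by linarith
    rw [hc0', hc1'] at r13
    norm_num at r13
  · have hc0' : c0 = -124 / 33 := by linarith
    have hc1' : c1 = -124 / 33 := by linarith
    rw [hc0', hc1'] at r13
    norm_num at r13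

/-! ### Part G. The first two graphs are the HCP and FCC contact graphs -/

/-- The relabelling taking graph `0` (`23761971401`) to the HCP table `hcpTab` of
`KissingRigidity.lean`. [folklore] -/
def tamePermHcp : Fin 12 → Fin 12 := ![0, 7, 6, 2, 9, 10, 4, 8, 1, 5, 3, 11]

/-- The relabelling taking graph `1` (`19501320227`) to the FCC table `fccTab` of
`KissingRigidity.lean`. [folklore] -/
def tamePermFcc : Fin 12 → Fin 12 := ![0, 4, 1, 5, 9, 11, 7, 10, 3, 8, 6, 2]

/-- `tamePermHcp` is a bijection. [folklore] -/
theorem tamePermHcp_bijective : Function.Bijective tamePermHcp := by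
  rw [Fintype.bijective_iff_injective_and_card]
  exact ⟨by decide, rfl⟩

/-- `tamePermFcc` is a bijection. [folklore] -/
theorem tamePermFcc_bijective : Function.Bijective tamePermFcc := by
  rw [Fintype.bijective_iff_injective_and_card]
  exact ⟨by decide, rfl⟩

/-- Graph `0` is the HCP contact relation `hcpAdj` up to the relabelling `tamePermHcp`.
[cite: Hales2012, Lemma 9 (proof: "Two are the hypermaps of the FCC and HCP")] -/
theorem tameContactGraph_zero_adj_iff :
    ∀ a b, (tameContactGraph 0).Adj a b ↔ hcpAdj (tamePermHcp a) (tamePermHcp b) := by decide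

/-- Graph `1` is the FCC contact relation `fccAdj` up to the relabelling `tamePermFcc`.
[cite: Hales2012, Lemma 9 (proof: "Two are the hypermaps of the FCC and HCP")] -/
theorem tameContactGraph_one_adj_iff :
    ∀ a b, (tameContactGraph 1).Adj a b ↔ fccAdj (tamePermFcc a) (tamePermFcc b) := by decide

/-- An enumerated model `i ↦ refPt N (tab i)` with contact relation read off from a graph `G` on
`Fin 12` along a bijective relabelling gives `G ≃g contactGraph (range)`. [folklore] -/
theorem nonempty_iso_contactGraph_range_refPt {N : ℕ} (hN : N ≠ 0) {tab : Fin 12 → Fin 3 → ℤ}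
    (htab : Function.Injective tab) {G : SimpleGraph (Fin 12)} {perm : Fin 12 → Fin 12}
    (hperm : Function.Bijective perm)
    (hadj : ∀ a b, G.Adj a b ↔ sqNormInt (tab (perm a) - tab (perm b)) = N) :
    Nonempty (G ≃g contactGraph (Set.range fun i => refPt N (tab i))) := by
  have hinj : Function.Injective fun i => refPt N (tab i) := (refPt_injective hN).comp htab
  let f : Fin 12 → ↥(Set.range fun i => refPt N (tab i)) := fun a =>
    ⟨refPt N (tab (perm a)), perm a, rfl⟩
  have hf : Function.Bijective f := by
    constructor
    · intro a b h
      have h' := congrArg Subtype.val h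
      exact hperm.1 (hinj h')
    · rintro ⟨_, i, rfl⟩
      obtain ⟨a, rfl⟩ := hperm.2 i
      exact ⟨a, rfl⟩
  refine ⟨⟨Equiv.ofBijective f hf, ?_⟩⟩
  intro a b
  simp only [Equiv.ofBijective_apply, contactGraph_adj]
  change dist (refPt N (tab (perm a))) (refPt N (tab (perm b))) = 2 ↔ G.Adj a b
  rw [dist_refPt_eq_two_iff hN, hadj]

/-- **Graph `0` of the list is the HCP contact graph.** [cite: Hales2012, Lemma 9 ("Two are the
hypermaps of the FCC and HCP")] -/
theorem nonempty_tameContactGraph_zero_iso_hcp :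
    Nonempty (tameContactGraph 0 ≃g contactGraph
      ((fun p => (2 : ℝ) • p) '' (hcpKissingPattern : Set (EuclideanSpace ℝ (Fin 3))))) := by
  rw [two_smul_image_hcp_eq_range]
  exact nonempty_iso_contactGraph_range_refPt (by norm_num) hcpTab_injective tamePermHcp_bijective
    tameContactGraph_zero_adj_iff

/-- **Graph `1` of the list is the FCC contact graph.** [cite: Hales2012, Lemma 9 ("Two are the
hypermaps of the FCC and HCP")] -/
theorem nonempty_tameContactGraph_one_iso_fcc :
    Nonempty (tameContactGraph 1 ≃g contactGraph
      ((fun p => (2 : ℝ) • p) '' (fccKissingPattern : Set (EuclideanSpace ℝ (Fin 3))))) := by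
  rw [two_smul_image_fcc_eq_range]
  exact nonempty_iso_contactGraph_range_refPt two_ne_zero fccTab_injective tamePermFcc_bijective
    tameContactGraph_one_adj_iff

/-! ### Part H. The named fact (Theorem 3 with Lemma 8, graph form) and the assembly -/

/-- **Hales 2012, Theorem 3 with Lemma 8 (graph form): the contact graph of a kissing
configuration is one of the eight tame-contact graphs.**  Theorem 3: "The contact hypermap
`hyp(V, E₂(V))` of a packing `V ∈ 𝒱` is a hypermap with tame contact."  Lemma 8: "Every
hypermap with tame contact is isomorphic to a hypermap in the given list of eight hypermaps, or
is isomorphic to the opposite of a hypermap in the list."  Vendored through the underlying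
graphs (implied by the printed statements: an isomorphism of hypermaps — or with the opposite
hypermap, which has the same nodes and edges — induces an isomorphism of their graphs, and the
graph of `hyp(V, E₂(V))` is the contact graph `(V, E₂(V))`, on all of `V` since a tame-contact
hypermap has twelve nodes, property 8 of Definition 12): for every `V ∈ 𝒱`
(`IsKissingConfig`, Definition 1) the contact graph is isomorphic to `tameContactGraph i` for
some `i : Fin 8`.  Computer-assisted (the hypermap generator run PYWHMHQ of [Hal12b]; Theorem 3
rests on the main estimate, Theorem 2, a Mathematica computation, and on Lemmas 3–7).  The
classification PYWHMHQ (in this graph form) and the Mathematica table of Theorem 2 have been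
independently re-derived (2026-08-15, evidence on ledger item `wi-04917`; see the module
docstring); Theorem 3 itself (text) is why this stays a named fact.
[cite: Hales2012, Theorem 3 and Lemma 8; HalesFlyspeck2012 (fejesToth.txt, PYWHMHQ)] -/
def Hales2012_contactGraphTame : Prop :=
  ∀ S : Set (EuclideanSpace ℝ (Fin 3)), IsKissingConfig S →
    ∃ i : Fin 8, Nonempty (contactGraph S ≃g tameContactGraph i)

/-- Consistency: the FCC and HCP configurations themselves satisfy the conclusion of
`Hales2012_contactGraphTame` (with `i = 1` and `i = 0`). [folklore] -/
theorem contactGraphTame_fcc_hcp :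
    (∃ i : Fin 8, Nonempty (contactGraph ((fun p => (2 : ℝ) • p) ''
      (fccKissingPattern : Set (EuclideanSpace ℝ (Fin 3)))) ≃g tameContactGraph i)) ∧
    (∃ i : Fin 8, Nonempty (contactGraph ((fun p => (2 : ℝ) • p) ''
      (hcpKissingPattern : Set (EuclideanSpace ℝ (Fin 3)))) ≃g tameContactGraph i)) :=
  ⟨⟨1, nonempty_tameContactGraph_one_iso_fcc.map fun e => e.symm⟩,
    ⟨0, nonempty_tameContactGraph_zero_iso_hcp.map fun e => e.symm⟩⟩

/-- **Hales 2012, Lemma 9 — proved (graph form).** "Let `V ∈ 𝒱`. Suppose that `H = hyp(V, E₂(V))`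
is a hypermap with tame contact. Then `H` is the FCC or HCP contact hypermap."  Given Theorem 3
with Lemma 8 in graph form (`Hales2012_contactGraphTame`), the contact graph of every `V ∈ 𝒱` is
the FCC or the HCP contact graph (`Hales2012_contactGraphFccOrHcp` of
`FejesTothKissingTwelve.lean`): graphs `2, …, 7` are excluded by Parts C–F and graphs `0, 1` are
the HCP and FCC graphs by Part G. [cite: Hales2012, Lemma 9] -/
theorem contactGraphFccOrHcp_of_contactGraphTame (h : Hales2012_contactGraphTame) :
    Hales2012_contactGraphFccOrHcp := by
  intro S hS
  obtain ⟨i, ⟨φ⟩⟩ := h S hS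
  fin_cases i
  · obtain ⟨e⟩ := nonempty_tameContactGraph_zero_iso_hcp
    exact Or.inr ⟨φ.trans e⟩
  · obtain ⟨e⟩ := nonempty_tameContactGraph_one_iso_fcc
    exact Or.inl ⟨φ.trans e⟩
  · exact (hS.isEmpty_iso_tameContactGraph_two.false φ).elim
  · exact (hS.isEmpty_iso_tameContactGraph_three.false φ).elim
  · exact (hS.isEmpty_iso_tameContactGraph_four.false φ).elim
  · exact (hS.isEmpty_iso_tameContactGraph_five.false φ).elim
  · exact (hS.isEmpty_iso_tameContactGraph_six.false φ).elim
  · exact (hS.isEmpty_iso_tameContactGraph_seven.false φ).elim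

/-- Hence, with Lemma 10 (`KissingRigidity.lean`): every kissing configuration is congruent to the
FCC or the HCP configuration, given Theorem 3 with Lemma 8. [cite: Hales2012, Lemmas 9 and 10] -/
theorem kissingConfigCongruent_of_contactGraphTame (h : Hales2012_contactGraphTame) :
    Hales2012_kissingConfigCongruent :=
  kissingConfigCongruent_of_contactGraphFccOrHcp (contactGraphFccOrHcp_of_contactGraphTame h)

/-- **Theorem 1 from the two computer-assisted named facts** `flyspeck_L12` (Lemma 1) and
`Hales2012_contactGraphTame` (Theorem 3 with Lemma 8), everything else — Lemma 2, Lemma 7,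
Lemma 9, Lemma 10 and the assembly — being proved.
[cite: Hales2012, Theorem 1 (proof, pp. 2 and 14)] -/
theorem hales2012_kissingTwelve_of_L12_of_contactGraphTame (hL12 : flyspeck_L12)
    (h8 : Hales2012_contactGraphTame) : Hales2012_kissingTwelve :=
  hales2012_kissingTwelve_of_L12_of_contactGraph hL12 (contactGraphFccOrHcp_of_contactGraphTame h8)

/-- And Fejes Tóth's conjecture from `flyspeck_L12`, Theorem 3 with Lemma 8, and *Dense Sphere
Packings* §1.3. [cite: Hales2012, §1] -/
theorem fejesTothKissingTwelve_of_L12_of_contactGraphTame (hL12 : flyspeck_L12)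
    (h8 : Hales2012_contactGraphTame) (h2 : HalesDSP_layerPackings) : FejesTothKissingTwelve :=
  fejesTothKissingTwelve_of_L12_of_contactGraph hL12 (contactGraphFccOrHcp_of_contactGraphTame h8)
    h2

end Literature.Geometry.DiscreteGeometry
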